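import Mathlib
import Literature.Barriers.MatrixMultiplication.NormalizerBarrier
import Summits.MatrixMultiplication.MatrixMultiplication.Theorems.LieRankDesigns.Negative.Basics
import Summits.MatrixMultiplication.MatrixMultiplication.Theorems.SubgroupIdentityDesigns.Negative.GrassmannNoGo
import Summits.MatrixMultiplication.MatrixMultiplication.Theorems.SubgroupIdentityDesigns.Negative.GrassmannOrbits

/-!
# General-`k` block-slice no-go — unconditional (BLOCK-SLICES Thm 2.4 for all `k ≥ 1`, `l ≥ 3k + 6`)

Supports stmt-MatrixMultiplication-14079 (route `LevelGradedCohnUmans`).  VALUE = theorem, NOT summit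
progress.  Combining `GrassmannNoGo.no_translate_witness_of_norm` (the no-go conditional on
`⟨Φ_k, Φ_k⟩ ≤ k + 1`, `Φ_k = Ind_{P_k}^G 1` the permutation character of `G = GL_{k+l}(𝔽_p)` on
`k`-subspaces) with `GrassmannOrbits.classInner_grassChar_le` (`⟨Φ_k, Φ_k⟩ = #(P_k-orbits) ≤ k + 1`,
Bruhat + block-permutation double cosets):

* `no_translate_witness` — for every prime `p`, every `k ≥ 1`, `l ≥ 3k + 6` and every `ε > 0`:
  NO subgroup-TPP triple `H₁, H₂, H₃ ≤ GL_{k+l}(𝔽_p)` whose products `abc` lie in a two-sided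
  translate `x · S_{k+l,k} · y` of the block slice `S_{k+l,k} = {g : lower-right l×l block = 1}`
  satisfies the crux inequality `∑_{ψ ∈ Irr ∩ F_k} ψ(1)^{2+ε} < (|H₁||H₂||H₃|)^{(2+ε)/3}`;
* `no_slice_witness` — the slice itself (`x = y = 1`).

So the rank-`≤ k` Fourier-design witnesses of `SubgroupIdentityDesigns` cannot come from block
slices (the only source of rank-graded identity tests found so far) once `m ≥ 4k + 6`; the cases
`k = 1`, `l ≥ 3` (all `ε`) and `l ≥ 1` (`ε ≤ 1`) are `BlockSliceTranslate.no_translate_witness_one` /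
`PrincipalSeriesBudget`.
-/

set_option linter.dupNamespace false

noncomputable section

open scoped BigOperators Matrix Classical
open Literature.Barriers.MatrixMultiplication (SubgroupTPP)
open Literature.RepresentationTheory.FiniteGroups
open Summit.MatrixMultiplication.MatrixMultiplication.Theorems.LieRankDesigns.Negative

namespace Summit.MatrixMultiplication.MatrixMultiplication.Theorems.SubgroupIdentityDesigns.Negative
namespace BlockSliceGeneral

variable {p : ℕ} [hp : Fact p.Prime] {k l : ℕ}

/-- **General-`k` block-slice no-go (unconditional).**  For `k ≥ 1`, `l ≥ 3k + 6`, any prime `p`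
and any `ε > 0`, no subgroup-TPP triple with products in a translate `x S_{k+l,k} y` of the block
slice satisfies the budget inequality of the crux `SubgroupIdentityDesigns`. -/
theorem no_translate_witness (hk : 1 ≤ k) (hl : 3 * k + 6 ≤ l)
    {H₁ H₂ H₃ : Subgroup (GLm p (k + l))} (htpp : SubgroupTPP H₁ H₂ H₃) (x y : GLm p (k + l))
    (hS : ∀ a ∈ H₁, ∀ b ∈ H₂, ∀ c ∈ H₃, ∀ i j : Fin l,
      ((x⁻¹ * (a * b * c) * y⁻¹ : GLm p (k + l)) : Mat p (k + l)) (Fin.natAdd k i)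
          (Fin.natAdd k j) = (1 : Matrix (Fin l) (Fin l) (ZMod p)) i j)
    {ε : ℝ} (hε : 0 < ε) :
    ¬ ((∑ᶠ ψ ∈ irrChars (GLm p (k + l)) ∩ levelSet p (k + l) k, (ψ 1).re ^ (2 + ε)) <
        ((Nat.card H₁ * Nat.card H₂ * Nat.card H₃ : ℕ) : ℝ) ^ ((2 + ε) / 3)) :=
  GrassmannNoGo.no_translate_witness_of_norm hk hl GrassmannOrbits.classInner_grassChar_le
    htpp x y hS hε

/-- The block slice itself (`x = y = 1`): products `abc` with lower-right `l × l` block `= 1`. -/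
theorem no_slice_witness (hk : 1 ≤ k) (hl : 3 * k + 6 ≤ l)
    {H₁ H₂ H₃ : Subgroup (GLm p (k + l))} (htpp : SubgroupTPP H₁ H₂ H₃)
    (hS : ∀ a ∈ H₁, ∀ b ∈ H₂, ∀ c ∈ H₃, ∀ i j : Fin l,
      ((a * b * c : GLm p (k + l)) : Mat p (k + l)) (Fin.natAdd k i) (Fin.natAdd k j) =
        (1 : Matrix (Fin l) (Fin l) (ZMod p)) i j)
    {ε : ℝ} (hε : 0 < ε) :
    ¬ ((∑ᶠ ψ ∈ irrChars (GLm p (k + l)) ∩ levelSet p (k + l) k, (ψ 1).re ^ (2 + ε)) <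
        ((Nat.card H₁ * Nat.card H₂ * Nat.card H₃ : ℕ) : ℝ) ^ ((2 + ε) / 3)) :=
  no_translate_witness hk hl htpp 1 1
    (fun a ha b hb c hc i j => by simpa using hS a ha b hb c hc i j) hε

/-- The same in terms of `m = k + l`: for `m ≥ 4k + 6` no subgroup-TPP triple of `GL_m(𝔽_p)` with
products in the slice `S_{m,k}` beats the level-`k` budget with exponent `2 + ε`. -/
theorem no_slice_witness' (hk : 1 ≤ k) {m : ℕ} (hm : 4 * k + 6 ≤ m) :
    ∃ l, m = k + l ∧ ∀ {H₁ H₂ H₃ : Subgroup (GLm p (k + l))}, SubgroupTPP H₁ H₂ H₃ →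
      (∀ a ∈ H₁, ∀ b ∈ H₂, ∀ c ∈ H₃, ∀ i j : Fin l,
        ((a * b * c : GLm p (k + l)) : Mat p (k + l)) (Fin.natAdd k i) (Fin.natAdd k j) =
          (1 : Matrix (Fin l) (Fin l) (ZMod p)) i j) →
      ∀ {ε : ℝ}, 0 < ε →
        ¬ ((∑ᶠ ψ ∈ irrChars (GLm p (k + l)) ∩ levelSet p (k + l) k, (ψ 1).re ^ (2 + ε)) <
            ((Nat.card H₁ * Nat.card H₂ * Nat.card H₃ : ℕ) : ℝ) ^ ((2 + ε) / 3)) :=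
  ⟨m - k, by omega, fun htpp hS _ hε => no_slice_witness hk (by omega) htpp hS hε⟩

end BlockSliceGeneral
end Summit.MatrixMultiplication.MatrixMultiplication.Theorems.SubgroupIdentityDesigns.Negative
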